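import Summits.AtomisticToContinuum.HydrodynamicLimit.Theorems.RelayRaceLocalityNearConstantShortTimeHLTiltL2Defs
import Summits.AtomisticToContinuum.HydrodynamicLimit.Theorems.RelayRaceLocalityNearConstantShortTimeHLGeneralFamilyConcentrationContraction
import Summits.AtomisticToContinuum.HydrodynamicLimit.Theorems.CollisionIsometryCLTMesoscopicLLNTreeBound
import Summits.AtomisticToContinuum.HydrodynamicLimit.Theorems.RelayRaceLocalityNearConstantShortTimeHLTiltL2Variance
import HarnessLib

/-!
# Crux `NearConstantShortTimeHL` (stmt-AtomisticToContinuum-12502), line `small-tilt-domination` —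
# the one-point shift bound `InsertionRatioLipschitz → OnePointShift`

Registered stub `tl_onePointShift` of the `L²` route to `BallTiltLogLaplace` (typed statements in
`…TiltL2Defs`). For the canonical hard-core gas of `n` labels with one-particle law `μ_P` at scale `ε`
under the smallness `n p_ε ≤ λ₀`, the one-point expectation `A(m) = M^g(m)/Ξ(m) = E_m[g(x₀)]` of a bounded
measurable decoration `g` moves by at most `K (∫ |g| dμ_P)/m` when ONE particle is added (`2 ≤ m < n`):

* `A(m) = Σ_{j<m} C(m-1,j) W^g(j+1) Ξ(m-1-j)/Ξ(m)` (`Md_eq_sum` divided by `Ξ(m) > 0`);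
* `C(m,j) |W^g(j+1)| ≤ (∫|g| dμ) e (eλ)ʲ` — the tree-graph bound with the `L¹` norm at the root
  (`tlv_choose_mul_abs_Wd_le` of `…TiltL2Variance`: `MesoLLN.abs_Wd_le_integral`, `C(m,j) ≤ mʲ/j!`);
* Pascal's rule `m (C(m,j) - C(m-1,j)) = j C(m,j)` and the increments of the ratio products
  `|Ξ(m-j)/Ξ(m+1) - Ξ(m-1-j)/Ξ(m)| ≤ (j+1) 2^{j+1} max_{l ≤ j} |q(m-l) - q(m-1-l)|`, `q(k) = Ξ(k)/Ξ(k+1) ≤ 2`,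
  where the HYPOTHESIS `InsertionRatioLipschitz` gives `|q(k+1) - q(k)| ≤ B/(k+1)`;
* the resulting finite sums are dominated by the geometric series `Σ (8eλ)ʲ ≤ 2` (`λ₀ ≤ 1/100`).

No definitions. Source: E. Pulvirenti – D. Tsagkarogiannis, Comm. Math. Phys. 316 (2012) 289–306, §3–5.
-/

noncomputable section

namespace Summit.AtomisticToContinuum.HydrodynamicLimit.Theorems.NearConstantShortTimeHL

open MeasureTheory ProbabilityTheory Finset Filter Topology
open scoped ENNReal BigOperators
open Literature.MathematicalPhysics.KineticTheory Literature.MathematicalPhysics.StatisticalMechanics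
open Literature.Probability.LatticeModels

/-! ### Elementary numerics -/

/-- `(j+1)² B + j ≤ 4ʲ (B+1)` for `0 ≤ B` (from `j + 1 ≤ 2ʲ`). [folklore] -/
theorem tls_key_numerics (j : ℕ) {B : ℝ} (hB : 0 ≤ B) :
    ((j : ℝ) + 1) ^ 2 * B + j ≤ 4 ^ j * (B + 1) := by
  have h : (j : ℝ) + 1 ≤ (2 : ℝ) ^ j := by exact_mod_cast Nat.succ_le_of_lt Nat.lt_two_pow_self
  have h4 : ((2 : ℝ) ^ j) ^ 2 = 4 ^ j := by
    rw [sq, ← mul_pow]; norm_num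
  have hj : (0 : ℝ) ≤ j := Nat.cast_nonneg j
  have hsq : ((j : ℝ) + 1) ^ 2 ≤ ((2 : ℝ) ^ j) ^ 2 := pow_le_pow_left₀ (by positivity) h 2
  rw [h4] at hsq
  nlinarith [mul_le_mul_of_nonneg_right hsq hB, sq_nonneg (j : ℝ)]

/-- `∑_{i<k} xⁱ ≤ 2` for `0 ≤ x ≤ 1/2`. [folklore] -/
theorem tls_geom_sum_le_two {x : ℝ} (hx0 : 0 ≤ x) (hx : x ≤ 1 / 2) (k : ℕ) :
    ∑ i ∈ range k, x ^ i ≤ 2 := by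
  have h := geom_sum_mul_neg x k
  have hS : 0 ≤ ∑ i ∈ range k, x ^ i := sum_nonneg fun i _ => pow_nonneg hx0 i
  have hxk : 0 ≤ x ^ k := pow_nonneg hx0 k
  nlinarith

/-- Pascal's rule in the form `m (C(m,j) - C(m-1,j)) = j C(m,j)` for `1 ≤ m`. [folklore] -/
theorem tls_choose_pascal {m : ℕ} (hm : 1 ≤ m) (j : ℕ) :
    (m : ℝ) * ((m.choose j : ℝ) - ((m - 1).choose j : ℝ)) = (j : ℝ) * (m.choose j : ℝ) := by
  obtain ⟨k, rfl⟩ : ∃ k, m = k + 1 := ⟨m - 1, by omega⟩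
  rw [Nat.add_sub_cancel]
  cases j with
  | zero => simp
  | succ i =>
      have h1 : ((k + 1).choose (i + 1) : ℝ) = (k.choose i : ℝ) + (k.choose (i + 1) : ℝ) := by
        rw [Nat.choose_succ_succ']; push_cast; ring
      have h2 : ((k : ℝ) + 1) * (k.choose i : ℝ) = ((k + 1).choose (i + 1) : ℝ) * ((i : ℝ) + 1) := by
        exact_mod_cast Nat.add_one_mul_choose_eq k i
      rw [h1] at h2
      push_cast
      rw [h1]
      linear_combination h2

/-- **Per-term algebra of the shift bound.** With `c = C(m,j) ≥ c' = C(m-1,j) ≥ 0`, `m (c - c') = j c`,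
`0 ≤ R' ≤ T`, `c |W|, c' |W| ≤ IE` and `c' |R' - R| ≤ c' D`:
`|W (c R' - c' R)| ≤ IE · D + IE · j T/m`. [folklore] -/
theorem tls_term_le {W c c' R R' IE D T j m : ℝ} (hm : 0 < m) (hc' : 0 ≤ c') (hcc' : c' ≤ c)
    (hpas : m * (c - c') = j * c) (hj : 0 ≤ j) (hR'0 : 0 ≤ R') (hR'T : R' ≤ T)
    (hcW : c * |W| ≤ IE) (hc'W : c' * |W| ≤ IE) (hD : 0 ≤ D) (hRR : c' * |R' - R| ≤ c' * D) :
    |W * (c * R' - c' * R)| ≤ IE * D + IE * (j * T / m) := by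
  have hc : 0 ≤ c := hc'.trans hcc'
  have hT : 0 ≤ T := hR'0.trans hR'T
  have hsplit : c * R' - c' * R = c' * (R' - R) + (c - c') * R' := by ring
  have hcc : c - c' = j * c / m := by
    rw [eq_div_iff hm.ne']
    linear_combination hpas
  rw [hsplit, abs_mul]
  calc |W| * |c' * (R' - R) + (c - c') * R'|
      ≤ |W| * (|c' * (R' - R)| + |(c - c') * R'|) :=
        mul_le_mul_of_nonneg_left (abs_add_le _ _) (abs_nonneg _)
    _ = |W| * (c' * |R' - R|) + (c * |W|) * (j * R' / m) := by
        rw [abs_mul, abs_mul, abs_of_nonneg hc', abs_of_nonneg (sub_nonneg.2 hcc'), abs_of_nonneg hR'0,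
          mul_add, hcc]
        ring
    _ ≤ |W| * (c' * D) + (c * |W|) * (j * T / m) :=
        add_le_add (mul_le_mul_of_nonneg_left hRR (abs_nonneg _))
          (mul_le_mul_of_nonneg_left
            (div_le_div_of_nonneg_right (mul_le_mul_of_nonneg_left hR'T hj) hm.le)
            (mul_nonneg hc (abs_nonneg _)))
    _ = (c' * |W|) * D + (c * |W|) * (j * T / m) := by ring
    _ ≤ IE * D + IE * (j * T / m) :=
        add_le_add (mul_le_mul_of_nonneg_right hc'W hD)
          (mul_le_mul_of_nonneg_right hcW (div_nonneg (mul_nonneg hj hT) hm.le))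

/-! ### The increments of the ratio products at a fixed scale -/

section Bounds

variable {P : DensityProfile} {e lam : ℝ} {n : ℕ}
  (he : 0 ≤ e) (he2 : e < 1 / 2) (hnp : (n : ℝ) * pOv P e ≤ lam) (hlam1 : lam < 1) (hlam2 : lam ≤ 1 / 2)
include he he2 hnp hlam1 hlam2

/-- **Increments of the ratio products in the particle number**: if
`|q(m-l) - q(m-1-l)| ≤ δ` for `l < i` (`q(k) = Ξ(k)/Ξ(k+1)`, written at `k = m-1-l`), then
`|Ξ(m+1-i)/Ξ(m+1) - Ξ(m-i)/Ξ(m)| ≤ i 2ⁱ δ` (`i ≤ m < n`, `λ ≤ 1/2`; recursion `gf_r_succ`, `q ≤ 2`,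
`Ξ(m-i)/Ξ(m) ≤ 2ⁱ`). [folklore] -/
theorem tls_abs_r_sub_r_le {m : ℕ} (hm : m < n) {δ : ℝ} : ∀ {i : ℕ}, i ≤ m →
    (∀ l < i, |Xi P e n (m - 1 - l + 1) / Xi P e n (m - 1 - l + 2) -
      Xi P e n (m - 1 - l) / Xi P e n (m - 1 - l + 1)| ≤ δ) →
    |Xi P e n (m + 1 - i) / Xi P e n (m + 1) - Xi P e n (m - i) / Xi P e n m| ≤ i * 2 ^ i * δ := by
  intro i
  induction i with
  | zero =>
      intro _ _
      rw [gf_r_zero he he2 hnp hlam1 (by omega : m + 1 ≤ n), gf_r_zero he he2 hnp hlam1 (by omega : m ≤ n),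
        sub_self, abs_zero]
      simp
  | succ i ih =>
      intro hi hq
      have hδ : 0 ≤ δ := (abs_nonneg _).trans (hq i (Nat.lt_succ_self i))
      have ih' := ih (by omega) fun l hl => hq l (Nat.lt_succ_of_lt hl)
      have hqi := hq i (Nat.lt_succ_self i)
      rw [show m - 1 - i + 1 = m - i by omega, show m - 1 - i + 2 = m - i + 1 by omega] at hqi
      rw [gf_r_succ he he2 hnp hlam1 (by omega : m + 1 ≤ n) (by omega : i + 1 ≤ m + 1),
        gf_r_succ he he2 hnp hlam1 (by omega : m ≤ n) (by omega : i + 1 ≤ m)]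
      rw [show m + 1 - 1 - i = m - i by omega, show m - 1 - i + 1 = m - i by omega]
      set r' := Xi P e n (m + 1 - i) / Xi P e n (m + 1) with hr'
      set r := Xi P e n (m - i) / Xi P e n m with hr
      set q' := Xi P e n (m - i) / Xi P e n (m - i + 1) with hq'
      set q := Xi P e n (m - 1 - i) / Xi P e n (m - i) with hq_def
      have hr0 : 0 ≤ r := zero_le_one.trans (gf_one_le_r he he2 hnp hlam1 (by omega) (by omega))
      have hr2 : r ≤ 2 ^ i := gf_r_le_two_pow he he2 hnp hlam1 hlam2 (by omega) (by omega)
      have hq0 : 0 ≤ q' := zero_le_one.trans (gf_one_le_q he he2 hnp hlam1 (by omega))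
      have hq2 : q' ≤ 2 := gf_q_le_two he he2 hnp hlam1 hlam2 (by omega)
      have hsplit : r' * q' - r * q = (r' - r) * q' + r * (q' - q) := by ring
      rw [hsplit]
      calc |(r' - r) * q' + r * (q' - q)| ≤ |(r' - r) * q'| + |r * (q' - q)| := abs_add_le _ _
        _ = |r' - r| * q' + r * |q' - q| := by
            rw [abs_mul, abs_mul, abs_of_nonneg hq0, abs_of_nonneg hr0]
        _ ≤ (i * 2 ^ i * δ) * 2 + 2 ^ i * δ :=
            add_le_add (mul_le_mul ih' hq2 hq0 (mul_nonneg (by positivity) hδ))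
              (mul_le_mul hr2 hqi (abs_nonneg _) (by positivity))
        _ ≤ ((i + 1 : ℕ) : ℝ) * 2 ^ (i + 1) * δ := by
            have h2i : (0 : ℝ) ≤ 2 ^ i * δ := mul_nonneg (pow_nonneg zero_le_two i) hδ
            push_cast
            rw [pow_succ]
            nlinarith [h2i]

end Bounds

/-! ### The one-point shift bound -/

/-- **ONE-POINT SHIFT BOUND from the Lipschitz dependence of the insertion ratios.** If the inverse
insertion factors `q(m) = Ξ(m)/Ξ(m+1)` satisfy `|q(m+1) - q(m)| ≤ B/(m+1)` whenever `n p_ε ≤ λ₀'`, then with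
`λ₀ = min λ₀' (1/100)` and `K = 12 (B + 1)`: for every profile, scale `0 ≤ ε < 1/2`, `n` with `n p_ε ≤ λ₀`,
bounded measurable `g` and `2 ≤ m < n`,
`|M^g(m+1)/Ξ(m+1) - M^g(m)/Ξ(m)| ≤ K (∫ |g| dμ_P)/m` (decorated expansion `Md_eq_sum`, `L¹` tree bound at the
root, Pascal's rule, and the increments of the ratio products). [cite: PulvirentiTsagkarogiannis2012, §3] -/
theorem tl_onePointShift : InsertionRatioLipschitz → OnePointShift := by
  intro hQ
  obtain ⟨lamq, hlamq, B, hB, hq⟩ := hQ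
  refine ⟨min lamq (1 / 100), lt_min hlamq (by norm_num), 12 * (B + 1), by positivity, ?_⟩
  intro P e he he2 n _ hnp g hg C hgC m hm2 hmn
  set lam := min lamq (1 / 100) with hlam_def
  have hlam100 : lam ≤ 1 / 100 := min_le_right _ _
  have hnpq : (n : ℝ) * pOv P e ≤ lamq := hnp.trans (min_le_left _ _)
  have hlam0 : 0 ≤ lam := gf_lam_nonneg hnp he
  have hlam1 : lam < 1 := by linarith
  have hlam2 : lam ≤ 1 / 2 := by linarith
  have hexp1 : Real.exp 1 < 2.7182818286 := Real.exp_one_lt_d9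
  have hexp0 : 0 < Real.exp 1 := Real.exp_pos 1
  have h8 : 8 * Real.exp 1 * lam ≤ 1 / 2 := by
    have := mul_le_mul_of_nonneg_left hlam100 hexp0.le
    nlinarith
  have h80 : 0 ≤ 8 * Real.exp 1 * lam := mul_nonneg (mul_nonneg (by norm_num) hexp0.le) hlam0
  set I := ∫ y, |g y| ∂P.μ with hI_def
  have hI : 0 ≤ I := integral_nonneg fun y => abs_nonneg _
  have hm0 : (0 : ℝ) < m := by exact_mod_cast (by omega : 0 < m)
  have hIm : 0 ≤ I / m := div_nonneg hI hm0.le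
  -- Step 1: the two expansions divided by the partition functions, over the same range
  have hA : Md P e n g m / Xi P e n m = ∑ j ∈ range (m + 1),
      ((m - 1).choose j : ℝ) * Wd P e n g (j + 1) * (Xi P e n (m - 1 - j) / Xi P e n m) := by
    rw [Md_eq_sum hg hgC (by omega : 1 ≤ m) (by omega : m ≤ n), sum_div, sum_range_succ,
      Nat.choose_eq_zero_of_lt (by omega : m - 1 < m)]
    simp only [Nat.cast_zero, zero_mul, add_zero]
    exact sum_congr rfl fun j _ => by ring
  have hA' : Md P e n g (m + 1) / Xi P e n (m + 1) = ∑ j ∈ range (m + 1),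
      (m.choose j : ℝ) * Wd P e n g (j + 1) * (Xi P e n (m - j) / Xi P e n (m + 1)) := by
    rw [Md_eq_sum hg hgC (by omega : 1 ≤ m + 1) (by omega : m + 1 ≤ n), sum_div]
    refine sum_congr rfl fun j _ => ?_
    rw [show m + 1 - 1 = m from rfl]
    ring
  have hdiff : Md P e n g (m + 1) / Xi P e n (m + 1) - Md P e n g m / Xi P e n m =
      ∑ j ∈ range (m + 1), Wd P e n g (j + 1) *
        ((m.choose j : ℝ) * (Xi P e n (m - j) / Xi P e n (m + 1)) -
          ((m - 1).choose j : ℝ) * (Xi P e n (m - 1 - j) / Xi P e n m)) := by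
    rw [hA, hA', ← sum_sub_distrib]
    exact sum_congr rfl fun j _ => by ring
  -- Step 2: the per-term bound
  have hterm : ∀ j ∈ range (m + 1),
      |Wd P e n g (j + 1) *
        ((m.choose j : ℝ) * (Xi P e n (m - j) / Xi P e n (m + 1)) -
          ((m - 1).choose j : ℝ) * (Xi P e n (m - 1 - j) / Xi P e n m))| ≤
      I / m * (2 * Real.exp 1 * (B + 1)) * (8 * Real.exp 1 * lam) ^ j := by
    intro j hj
    rw [mem_range] at hj
    have hjn : j < n := by omega
    have hR'0 : 0 ≤ Xi P e n (m - j) / Xi P e n (m + 1) := div_nonneg (Xi_nonneg _) (Xi_nonneg _)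
    have hR'2 : Xi P e n (m - j) / Xi P e n (m + 1) ≤ 2 ^ (j + 1) := by
      have h := gf_r_le_two_pow he he2 hnp hlam1 hlam2 (m := m + 1) (j := j + 1) (by omega) (by omega)
      rwa [Nat.add_sub_add_right] at h
    have hc'0 : (0 : ℝ) ≤ ((m - 1).choose j : ℝ) := Nat.cast_nonneg _
    have hcc' : ((m - 1).choose j : ℝ) ≤ (m.choose j : ℝ) := by
      exact_mod_cast Nat.choose_le_choose j (Nat.sub_le m 1)
    have hpas := tls_choose_pascal (by omega : 1 ≤ m) j
    have hcW : (m.choose j : ℝ) * |Wd P e n g (j + 1)| ≤ I * (Real.exp 1 * (Real.exp 1 * lam) ^ j) :=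
      tlv_choose_mul_abs_Wd_le he he2 hnp hg hgC hjn (by omega)
    have hc'W : ((m - 1).choose j : ℝ) * |Wd P e n g (j + 1)| ≤ I * (Real.exp 1 * (Real.exp 1 * lam) ^ j) :=
      tlv_choose_mul_abs_Wd_le he he2 hnp hg hgC hjn (by omega)
    have hD : (0 : ℝ) ≤ (j + 1) * 2 ^ (j + 1) * (B * (j + 1) / m) := by positivity
    have hRR : ((m - 1).choose j : ℝ) *
        |Xi P e n (m - j) / Xi P e n (m + 1) - Xi P e n (m - 1 - j) / Xi P e n m| ≤
        ((m - 1).choose j : ℝ) * ((j + 1) * 2 ^ (j + 1) * (B * (j + 1) / m)) := by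
      rcases Nat.lt_or_ge j m with hjm | hjm
      · refine mul_le_mul_of_nonneg_left ?_ hc'0
        have h := tls_abs_r_sub_r_le he he2 hnp hlam1 hlam2 hmn (δ := B * ((j : ℝ) + 1) / (m : ℝ))
          (i := j + 1) (by omega) ?_
        · rw [Nat.add_sub_add_right, show m - (j + 1) = m - 1 - j by omega] at h
          push_cast at h
          exact h
        · intro l hl
          refine (hq P e he he2 n hnpq (m - 1 - l) (by omega)).trans ?_
          have h1 : ((m - 1 - l : ℕ) : ℝ) + 1 = (m : ℝ) - l := by
            rw [← Nat.cast_sub (by omega : l ≤ m)]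
            norm_cast
            omega
          have h2 : (l : ℝ) ≤ j := by exact_mod_cast (by omega : l ≤ j)
          have h3 : (j : ℝ) + 1 ≤ m := by exact_mod_cast (by omega : j + 1 ≤ m)
          have hml : (0 : ℝ) < m - l := by linarith
          rw [h1, div_le_div_iff₀ hml hm0]
          nlinarith [mul_nonneg (mul_nonneg hB.le (Nat.cast_nonneg j : (0 : ℝ) ≤ j)) (sub_nonneg.2 h3),
            mul_nonneg (mul_nonneg hB.le (by positivity : (0 : ℝ) ≤ j + 1)) (sub_nonneg.2 h2)]
      · rw [Nat.choose_eq_zero_of_lt (by omega : m - 1 < j), Nat.cast_zero, zero_mul, zero_mul]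
    have h := tls_term_le hm0 hc'0 hcc' hpas (Nat.cast_nonneg j : (0 : ℝ) ≤ j) hR'0 hR'2 hcW hc'W hD hRR
    refine h.trans ?_
    have hkey : ((j : ℝ) + 1) ^ 2 * B + j ≤ 4 ^ j * (B + 1) := tls_key_numerics j hB.le
    have h0 : 0 ≤ I / m * (2 * Real.exp 1) * (2 * Real.exp 1 * lam) ^ j :=
      mul_nonneg (mul_nonneg hIm (by positivity))
        (pow_nonneg (mul_nonneg (mul_nonneg zero_le_two hexp0.le) hlam0) j)
    calc I * (Real.exp 1 * (Real.exp 1 * lam) ^ j) * ((j + 1) * 2 ^ (j + 1) * (B * (j + 1) / m)) +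
          I * (Real.exp 1 * (Real.exp 1 * lam) ^ j) * (j * 2 ^ (j + 1) / m)
        = I / m * (2 * Real.exp 1) * (2 * Real.exp 1 * lam) ^ j * (((j : ℝ) + 1) ^ 2 * B + j) := by
          ring
      _ ≤ I / m * (2 * Real.exp 1) * (2 * Real.exp 1 * lam) ^ j * (4 ^ j * (B + 1)) :=
          mul_le_mul_of_nonneg_left hkey h0
      _ = I / m * (2 * Real.exp 1 * (B + 1)) * (8 * Real.exp 1 * lam) ^ j := by
          have h8j : (8 * Real.exp 1 * lam) ^ j = 4 ^ j * (2 * Real.exp 1 * lam) ^ j := by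
            rw [← mul_pow]; ring
          rw [h8j]; ring
  -- Step 3: sum up
  rw [hdiff]
  calc |∑ j ∈ range (m + 1), Wd P e n g (j + 1) *
          ((m.choose j : ℝ) * (Xi P e n (m - j) / Xi P e n (m + 1)) -
            ((m - 1).choose j : ℝ) * (Xi P e n (m - 1 - j) / Xi P e n m))|
      ≤ ∑ j ∈ range (m + 1), |Wd P e n g (j + 1) *
          ((m.choose j : ℝ) * (Xi P e n (m - j) / Xi P e n (m + 1)) -
            ((m - 1).choose j : ℝ) * (Xi P e n (m - 1 - j) / Xi P e n m))| :=
        abs_sum_le_sum_abs _ _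
    _ ≤ ∑ j ∈ range (m + 1), I / m * (2 * Real.exp 1 * (B + 1)) * (8 * Real.exp 1 * lam) ^ j :=
        sum_le_sum hterm
    _ = I / m * (2 * Real.exp 1 * (B + 1)) * ∑ j ∈ range (m + 1), (8 * Real.exp 1 * lam) ^ j := by
        rw [mul_sum]
    _ ≤ I / m * (2 * Real.exp 1 * (B + 1)) * 2 :=
        mul_le_mul_of_nonneg_left (tls_geom_sum_le_two h80 h8 _) (mul_nonneg hIm (by positivity))
    _ = I / m * (2 * Real.exp 1 * (B + 1) * 2) := by ring
    _ ≤ I / m * (12 * (B + 1)) := by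
        refine mul_le_mul_of_nonneg_left ?_ hIm
        nlinarith
    _ = 12 * (B + 1) * I / m := by ring

end Summit.AtomisticToContinuum.HydrodynamicLimit.Theorems.NearConstantShortTimeHL

end
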